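import Mathlib
import HarnessLib
import Summits.Ventures.LatticeQCDFlow.Scoring.ChainBurnIn

/-!
# Hoeffding's inequality for a Doeblin chain, from ANY start: the time average of a bounded
# observable has Gaussian tails `P(A_N − πf ≥ s) ≤ exp(−ε²(Ns − 4C'/ε)²/(8 N C'²))`

HONEST FRAMING: exact (Metropolis-corrected) sampling algorithms for lattice gauge theory;
figures of merit are autocorrelation/cost numbers at stated couplings and volumes; no
continuum-physics claim.

Venture `LatticeQCDFlow` (cell pub-lqcd), topic `Scoring`; FANOUT row 8 (`s0-cpn-nemc`, GEN-13).
NEW WORK of the cell, not a published result; no definition is introduced.  The row's error-bar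
files give SECOND MOMENTS (`Scoring/ChainTimeAverage.lean`, `Scoring/ChainMeanSquareError.lean`);
this file gives EXPONENTIAL TAILS (certified confidence statements) for the simulated chain
(Mathlib's `Kernel.trajMeasure`) of a Markov kernel minorised by its invariant law, started anywhere.
The proof is the martingale route with no conditional expectations: the Poisson solution
`h − Kh = f − πf` of `Scoring/DoeblinGreenKubo.lean` (`poisson_exists_of_doeblin`, `|h| ≤ 2C'/ε`)
turns `Σ (f(X_i) − πf)` into the martingale `M_n = Σ_{i<n} (h(X_{i+1}) − Kh(X_i))` plus a boundary
term `≤ 2‖h‖`; the tower property on observables (`Scoring/ChainTimeAverage.chain_tower`) and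
Mathlib's Hoeffding lemma (`hasSubgaussianMGF_of_mem_Icc`) applied to each law `κ(x, ·)` give
`E e^{tM_n} ≤ e^{n‖h‖²t²/2}`; the sub-Gaussian Chernoff bound (`HasSubgaussianMGF.measure_ge_le`)
finishes.  Printed counterpart NAMED ONLY: Glynn–Ormoneit 2002, *Hoeffding's inequality for
uniformly ergodic Markov chains*, Statist. Probab. Lett. 56 (named, not cited as a fact).

## Content (`κ` Markov; `P_{μ₀}` the trajectory law from ANY initial law `μ₀`)

* **`kop_exp_mul_le`** — Hoeffding's lemma for one step: `|h| ≤ B` ⇒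
  `(kop κ e^{t h})(x) ≤ exp(t (kop κ h)(x) + B² t²/2)`;
* **`chain_mgf_martingale_le`** — `E_{μ₀}[exp(t Σ_{i<n} (h(X_{i+1}) − (kop κ h)(X_i)))] ≤
  exp(n B² t²/2)` for every bounded measurable `h` and real `t`;
* `chain_martingale_tail_le` — `P_{μ₀}(M_n ≥ u) ≤ exp(−u²/(2(n+1)B²))`;
* **`chain_tail_le_exp_of_doeblin`** — with `π` invariant, `κ(x, ·) ≥ ε π` (`ε > 0`), `|f| ≤ C`,
  `C' = C + |πf|`, for every `N ≥ 1` and `s` with `N s ≥ 4C'/ε`: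
  `P_{μ₀}((1/N) Σ_{i<N} f(X_i) − πf ≥ s) ≤ exp(−(N s − 4C'/ε)² / (8 N C'²/ε²))`;
  `chain_abs_tail_le_exp_of_doeblin` — two-sided, factor `2`.  (The lattice instance for the exact
  flow sampler is `Scoring/FlowSamplerConfidence.lean`.)

Reading (value-free): a Doeblin certificate turns `N` updates from any start into an honest
confidence interval for every bounded observable, Gaussian tails of rate `ε² s²/(8 C'²)` per update;
no stationarity, no independence, no variance estimate.  NOT CLAIMED: any `ε` for a concrete sampler;
sharpness of the constants (no Bernstein form); unbounded observables.
-/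

noncomputable section

namespace Summit.Ventures.LatticeQCDFlow.Scoring

open MeasureTheory ProbabilityTheory Filter Finset Preorder
open scoped ENNReal NNReal

variable {Ω : Type*} [MeasurableSpace Ω]

/-! ### Hoeffding's lemma for one step of the kernel -/

section OneStep

variable (κ : Kernel Ω Ω) [IsMarkovKernel κ]

/-- **Hoeffding's lemma for one step**: for bounded measurable `h` (`|h| ≤ B`), every real `t` and
every state `x`: `∫ e^{t h(y)} κ(x, dy) ≤ exp(t (kop κ h)(x) + B² t²/2)`. -/
theorem kop_exp_mul_le {h : Ω → ℝ} (hh : Measurable h) {B : ℝ} (hB : ∀ x, |h x| ≤ B) (t : ℝ)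
    (x : Ω) :
    kop κ (fun y => Real.exp (t * h y)) x ≤ Real.exp (t * kop κ h x + B ^ 2 * t ^ 2 / 2) := by
  unfold kop
  have hmem : ∀ᵐ y ∂(κ x), h y ∈ Set.Icc (-B) B := ae_of_all _ fun y => abs_le.1 (hB y)
  have hsg := hasSubgaussianMGF_of_mem_Icc (μ := κ x) hh.aemeasurable hmem
  have hmgf := hsg.mgf_le t
  have hc : (((‖B - -B‖₊ / 2) ^ 2 : ℝ≥0) : ℝ) = B ^ 2 := by
    rw [NNReal.coe_pow, NNReal.coe_div, coe_nnnorm, Real.norm_eq_abs, sub_neg_eq_add]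
    rw [show B + B = 2 * B by ring, abs_mul, abs_two, NNReal.coe_ofNat, div_pow, mul_pow, sq_abs]
    ring
  rw [hc] at hmgf
  have hexp : (fun y => Real.exp (t * (h y - ∫ z, h z ∂(κ x))))
      = fun y => Real.exp (-(t * ∫ z, h z ∂(κ x))) * Real.exp (t * h y) := by
    funext y
    rw [← Real.exp_add]
    ring_nf
  have hkey : mgf (fun y => h y - ∫ z, h z ∂(κ x)) (κ x) t
      = Real.exp (-(t * ∫ z, h z ∂(κ x))) * ∫ y, Real.exp (t * h y) ∂(κ x) := by
    rw [mgf, hexp, integral_const_mul]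
  rw [hkey] at hmgf
  have hpos : 0 < Real.exp (t * ∫ z, h z ∂(κ x)) := Real.exp_pos _
  calc ∫ y, Real.exp (t * h y) ∂(κ x)
      = Real.exp (t * ∫ z, h z ∂(κ x))
          * (Real.exp (-(t * ∫ z, h z ∂(κ x))) * ∫ y, Real.exp (t * h y) ∂(κ x)) := by
        rw [← mul_assoc, ← Real.exp_add, add_neg_cancel, Real.exp_zero, one_mul]
    _ ≤ Real.exp (t * ∫ z, h z ∂(κ x)) * Real.exp (B ^ 2 * t ^ 2 / 2) :=
        mul_le_mul_of_nonneg_left hmgf hpos.le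
    _ = Real.exp (t * (∫ z, h z ∂(κ x)) + B ^ 2 * t ^ 2 / 2) := by rw [← Real.exp_add]

end OneStep

/-! ### The exponential supermartingale along the chain -/

section Chain

variable (κ : Kernel Ω Ω) [IsMarkovKernel κ] (μ₀ : Measure Ω) [IsProbabilityMeasure μ₀]

/-- **`E_{μ₀}[exp(t M_n)] ≤ exp(n B² t²/2)`** for the martingale
`M_n = Σ_{i<n} (h(X_{i+1}) − (kop κ h)(X_i))` of a bounded measurable `h` (`|h| ≤ B`), from any
initial law. -/
theorem chain_mgf_martingale_le {h : Ω → ℝ} (hh : Measurable h) {B : ℝ} (hB : ∀ x, |h x| ≤ B)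
    (t : ℝ) : ∀ n : ℕ,
    ∫ x, Real.exp (t * ∑ i ∈ Finset.range n, (h (x (i + 1)) - kop κ h (x i)))
        ∂(Kernel.trajMeasure (X := fun _ : ℕ => Ω) μ₀
          (fun m : ℕ => κ.comap (fun y : (i : ↥(Finset.Iic m)) → Ω => y ⟨m, Finset.mem_Iic.2 le_rfl⟩)
            (measurable_pi_apply _)))
      ≤ Real.exp (n * (B ^ 2 * t ^ 2 / 2))
  | 0 => by simp
  | n + 1 => by
    set P := Kernel.trajMeasure (X := fun _ : ℕ => Ω) μ₀
        (fun m : ℕ => κ.comap (fun y : (i : ↥(Finset.Iic m)) → Ω => y ⟨m, Finset.mem_Iic.2 le_rfl⟩)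
          (measurable_pi_apply _)) with hP
    have IH := chain_mgf_martingale_le hh hB t n
    rw [← hP] at IH
    have hB0 : 0 ≤ B := by
      obtain ⟨x⟩ := nonempty_of_isProbabilityMeasure μ₀
      exact (abs_nonneg _).trans (hB x)
    have hKb : ∀ x, |kop κ h x| ≤ B := abs_kop_le κ hB
    -- the history functional `F(X_{≤n}) = exp(t M_n − t Kh(X_n))`, through a padded path
    set pad : ((i : ↥(Finset.Iic n)) → Ω) → ℕ → Ω := fun y j =>
      if hj : j ≤ n then y ⟨j, Finset.mem_Iic.2 hj⟩ else y ⟨n, Finset.mem_Iic.2 le_rfl⟩ with hpad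
    have hpad_meas : ∀ j, Measurable fun y => pad y j := fun j => by
      by_cases hj : j ≤ n
      · simp only [hpad, hj, dite_true]; exact measurable_pi_apply _
      · simp only [hpad, hj, dite_false]; exact measurable_pi_apply _
    have hpad_eq : ∀ (x : ℕ → Ω) j, j ≤ n → pad (frestrictLe n x) j = x j := fun x j hj => by
      simp only [hpad, hj, dite_true, frestrictLe_apply]
    set F : ((i : ↥(Finset.Iic n)) → Ω) → ℝ := fun y =>
      Real.exp (t * ∑ i ∈ Finset.range n, (h (pad y (i + 1)) - kop κ h (pad y i))
        - t * kop κ h (pad y n)) with hF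
    have hFm : Measurable F := by
      refine Real.measurable_exp.comp ((measurable_const.mul (Finset.measurable_sum _ fun i _ =>
        (hh.comp (hpad_meas _)).sub ((measurable_kop κ hh).comp (hpad_meas _)))).sub
        (measurable_const.mul ((measurable_kop κ hh).comp (hpad_meas _))))
    have hsum_bd : ∀ y, |∑ i ∈ Finset.range n, (h (pad y (i + 1)) - kop κ h (pad y i))| ≤ n * (2 * B) :=
      fun y => by
      calc |∑ i ∈ Finset.range n, (h (pad y (i + 1)) - kop κ h (pad y i))|
          ≤ ∑ i ∈ Finset.range n, |h (pad y (i + 1)) - kop κ h (pad y i)| := Finset.abs_sum_le_sum_abs _ _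
        _ ≤ ∑ i ∈ Finset.range n, 2 * B := Finset.sum_le_sum fun i _ =>
            (abs_sub _ _).trans (by linarith [hB (pad y (i + 1)), hKb (pad y i)])
        _ = n * (2 * B) := by rw [Finset.sum_const, Finset.card_range, nsmul_eq_mul]
    have hFb : ∀ y, |F y| ≤ Real.exp (|t| * (n * (2 * B)) + |t| * B) := fun y => by
      rw [hF, Real.abs_exp]
      refine Real.exp_le_exp.2 ?_
      have h1 : t * ∑ i ∈ Finset.range n, (h (pad y (i + 1)) - kop κ h (pad y i))
          ≤ |t| * (n * (2 * B)) := by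
        refine (le_abs_self _).trans ?_
        rw [abs_mul]
        exact mul_le_mul_of_nonneg_left (hsum_bd y) (abs_nonneg _)
      have h2 : -(t * kop κ h (pad y n)) ≤ |t| * B := by
        refine (neg_le_abs _).trans ?_
        rw [abs_mul]
        exact mul_le_mul_of_nonneg_left (hKb _) (abs_nonneg _)
      linarith
    have hgm : Measurable fun y => Real.exp (t * h y) := Real.measurable_exp.comp (measurable_const.mul hh)
    have hgb : ∀ y, |Real.exp (t * h y)| ≤ Real.exp (|t| * B) := fun y => by
      rw [Real.abs_exp]
      refine Real.exp_le_exp.2 ((le_abs_self _).trans ?_)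
      rw [abs_mul]
      exact mul_le_mul_of_nonneg_left (hB y) (abs_nonneg _)
    have htower := chain_tower κ μ₀ n hFm hFb hgm hgb
    rw [← hP] at htower
    -- identify `F(X_{≤n})` along the path
    have hFx : ∀ x : ℕ → Ω, F (frestrictLe n x)
        = Real.exp (t * ∑ i ∈ Finset.range n, (h (x (i + 1)) - kop κ h (x i)) - t * kop κ h (x n)) :=
      fun x => by
      rw [hF]
      simp only []
      rw [hpad_eq x n le_rfl, Finset.sum_congr rfl fun i hi => by
        rw [hpad_eq x (i + 1) (Finset.mem_range.1 hi), hpad_eq x i (Finset.mem_range.1 hi).le]]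
    -- left side of the tower identity is the `(n+1)`-step exponential moment
    have hL : ∫ x, Real.exp (t * ∑ i ∈ Finset.range (n + 1), (h (x (i + 1)) - kop κ h (x i))) ∂P
        = ∫ x, F (frestrictLe n x) * Real.exp (t * h (x (n + 1))) ∂P := by
      refine integral_congr_ae (ae_of_all _ fun x => ?_)
      dsimp only
      rw [hFx x, ← Real.exp_add, Finset.sum_range_succ]
      ring_nf
    -- right side is bounded through the one-step Hoeffding lemma
    have hR : ∀ x : ℕ → Ω, F (frestrictLe n x) * kop κ (fun y => Real.exp (t * h y)) (x n)
        ≤ Real.exp (B ^ 2 * t ^ 2 / 2)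
          * Real.exp (t * ∑ i ∈ Finset.range n, (h (x (i + 1)) - kop κ h (x i))) := fun x => by
      rw [hFx x]
      calc Real.exp (t * ∑ i ∈ Finset.range n, (h (x (i + 1)) - kop κ h (x i)) - t * kop κ h (x n))
            * kop κ (fun y => Real.exp (t * h y)) (x n)
          ≤ Real.exp (t * ∑ i ∈ Finset.range n, (h (x (i + 1)) - kop κ h (x i)) - t * kop κ h (x n))
            * Real.exp (t * kop κ h (x n) + B ^ 2 * t ^ 2 / 2) :=
            mul_le_mul_of_nonneg_left (kop_exp_mul_le κ hh hB t (x n)) (Real.exp_pos _).le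
        _ = Real.exp (B ^ 2 * t ^ 2 / 2)
            * Real.exp (t * ∑ i ∈ Finset.range n, (h (x (i + 1)) - kop κ h (x i))) := by
            rw [← Real.exp_add, ← Real.exp_add]; ring_nf
    have hint : Integrable (fun x : ℕ → Ω =>
        Real.exp (t * ∑ i ∈ Finset.range n, (h (x (i + 1)) - kop κ h (x i)))) P := by
      refine integrable_of_bounded P (Real.measurable_exp.comp (measurable_const.mul
        (Finset.measurable_sum _ fun i _ => (hh.comp (measurable_pi_apply _)).sub
          ((measurable_kop κ hh).comp (measurable_pi_apply _))))) (C := Real.exp (|t| * (n * (2 * B))))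
        fun x => ?_
      rw [Real.abs_exp]
      refine Real.exp_le_exp.2 ((le_abs_self _).trans ?_)
      rw [abs_mul]
      refine mul_le_mul_of_nonneg_left ?_ (abs_nonneg _)
      calc |∑ i ∈ Finset.range n, (h (x (i + 1)) - kop κ h (x i))|
          ≤ ∑ i ∈ Finset.range n, |h (x (i + 1)) - kop κ h (x i)| := Finset.abs_sum_le_sum_abs _ _
        _ ≤ ∑ i ∈ Finset.range n, 2 * B := Finset.sum_le_sum fun i _ =>
            (abs_sub _ _).trans (by linarith [hB (x (i + 1)), hKb (x i)])
        _ = n * (2 * B) := by rw [Finset.sum_const, Finset.card_range, nsmul_eq_mul]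
    rw [hL, htower]
    calc ∫ x, F (frestrictLe n x) * kop κ (fun y => Real.exp (t * h y)) (x n) ∂P
        ≤ ∫ x, Real.exp (B ^ 2 * t ^ 2 / 2)
            * Real.exp (t * ∑ i ∈ Finset.range n, (h (x (i + 1)) - kop κ h (x i))) ∂P := by
          refine integral_mono_of_nonneg (ae_of_all _ fun x => ?_) (hint.const_mul _) (ae_of_all _ hR)
          simp only [Pi.zero_apply]
          rw [hFx x]
          exact mul_nonneg (Real.exp_pos _).le (integral_nonneg fun y => (Real.exp_pos _).le)
      _ = Real.exp (B ^ 2 * t ^ 2 / 2)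
            * ∫ x, Real.exp (t * ∑ i ∈ Finset.range n, (h (x (i + 1)) - kop κ h (x i))) ∂P :=
          integral_const_mul _ _
      _ ≤ Real.exp (B ^ 2 * t ^ 2 / 2) * Real.exp (n * (B ^ 2 * t ^ 2 / 2)) :=
          mul_le_mul_of_nonneg_left IH (Real.exp_pos _).le
      _ = Real.exp (((n + 1 : ℕ) : ℝ) * (B ^ 2 * t ^ 2 / 2)) := by
          rw [← Real.exp_add]; push_cast; ring_nf

/-- **Gaussian tail of the martingale**: `P_{μ₀}(M_n ≥ u) ≤ exp(−u²/(2 (n+1) B²))` for `u ≥ 0`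
(the parameter is taken as `(n+1)B²` so that it is positive whenever `B > 0`). -/
theorem chain_martingale_tail_le {h : Ω → ℝ} (hh : Measurable h) {B : ℝ} (hB : ∀ x, |h x| ≤ B)
    (n : ℕ) {u : ℝ} (hu : 0 ≤ u) :
    (Kernel.trajMeasure (X := fun _ : ℕ => Ω) μ₀
          (fun m : ℕ => κ.comap (fun y : (i : ↥(Finset.Iic m)) → Ω => y ⟨m, Finset.mem_Iic.2 le_rfl⟩)
            (measurable_pi_apply _))).real
        {x | u ≤ ∑ i ∈ Finset.range n, (h (x (i + 1)) - kop κ h (x i))}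
      ≤ Real.exp (-u ^ 2 / (2 * ((n + 1) * B ^ 2))) := by
  set P := Kernel.trajMeasure (X := fun _ : ℕ => Ω) μ₀
      (fun m : ℕ => κ.comap (fun y : (i : ↥(Finset.Iic m)) → Ω => y ⟨m, Finset.mem_Iic.2 le_rfl⟩)
        (measurable_pi_apply _)) with hP
  have hB0 : 0 ≤ B := by
    obtain ⟨x⟩ := nonempty_of_isProbabilityMeasure μ₀
    exact (abs_nonneg _).trans (hB x)
  have hKb : ∀ x, |kop κ h x| ≤ B := abs_kop_le κ hB
  have hMm : Measurable fun x : ℕ → Ω => ∑ i ∈ Finset.range n, (h (x (i + 1)) - kop κ h (x i)) :=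
    Finset.measurable_sum _ fun i _ => (hh.comp (measurable_pi_apply _)).sub
      ((measurable_kop κ hh).comp (measurable_pi_apply _))
  have hMb : ∀ x : ℕ → Ω, |∑ i ∈ Finset.range n, (h (x (i + 1)) - kop κ h (x i))| ≤ n * (2 * B) :=
    fun x => by
    calc |∑ i ∈ Finset.range n, (h (x (i + 1)) - kop κ h (x i))|
        ≤ ∑ i ∈ Finset.range n, |h (x (i + 1)) - kop κ h (x i)| := Finset.abs_sum_le_sum_abs _ _
      _ ≤ ∑ i ∈ Finset.range n, 2 * B := Finset.sum_le_sum fun i _ =>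
          (abs_sub _ _).trans (by linarith [hB (x (i + 1)), hKb (x i)])
      _ = n * (2 * B) := by rw [Finset.sum_const, Finset.card_range, nsmul_eq_mul]
  set c : ℝ≥0 := Real.toNNReal ((n + 1) * B ^ 2) with hc
  have hcr : (c : ℝ) = (n + 1) * B ^ 2 := by rw [hc]; exact Real.coe_toNNReal _ (by positivity)
  have hsg : HasSubgaussianMGF (fun x : ℕ → Ω => ∑ i ∈ Finset.range n, (h (x (i + 1)) - kop κ h (x i)))
      c P := by
    refine ⟨fun t => ?_, fun t => ?_⟩
    · exact integrable_of_bounded P (Real.measurable_exp.comp (measurable_const.mul hMm))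
        (C := Real.exp (|t| * (n * (2 * B)))) fun x => by
        rw [Real.abs_exp]
        refine Real.exp_le_exp.2 ((le_abs_self _).trans ?_)
        rw [abs_mul]
        exact mul_le_mul_of_nonneg_left (hMb x) (abs_nonneg _)
    · have h1 := chain_mgf_martingale_le κ μ₀ hh hB t n
      rw [← hP] at h1
      refine h1.trans (Real.exp_le_exp.2 ?_)
      rw [hcr]
      nlinarith [sq_nonneg B, sq_nonneg t, mul_nonneg (sq_nonneg B) (sq_nonneg t)]
  have h := hsg.measure_ge_le hu
  rw [hcr] at h
  exact h

end Chain

/-! ### The time average: Gaussian tails from any start under a Doeblin constant -/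

section Doeblin

variable {κ : Kernel Ω Ω} [IsMarkovKernel κ] {μ₀ : Measure Ω} [IsProbabilityMeasure μ₀]
  {π : Measure Ω} [IsProbabilityMeasure π]

/-- **HOEFFDING FOR A DOEBLIN CHAIN, ANY START.**  Let `π` be an invariant probability law of the
Markov kernel `κ` with `κ(x, ·) ≥ ε π` (`ε > 0`); `f` bounded measurable, `|f| ≤ C`, `C' = C + |πf|`.
For every initial law `μ₀`, every `N ≥ 1` and every `s` with `N s ≥ 4C'/ε`:
`P_{μ₀}((1/N) Σ_{i<N} f(X_i) − πf ≥ s) ≤ exp(−(N s − 4C'/ε)² / (8 N C'²/ε²))`. -/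
theorem chain_tail_le_exp_of_doeblin (hπ : Kernel.Invariant κ π) {ε : ℝ≥0∞}
    (hmin : ∀ x {B : Set Ω}, MeasurableSet B → ε * π B ≤ κ x B) (hε0 : 0 < ε)
    {f : Ω → ℝ} (hf : Measurable f) {C : ℝ} (hC : ∀ x, |f x| ≤ C) {N : ℕ} (hN : N ≠ 0) {s : ℝ}
    (hs : 4 * (C + |∫ z, f z ∂π|) / ε.toReal ≤ N * s) :
    (Kernel.trajMeasure (X := fun _ : ℕ => Ω) μ₀
          (fun m : ℕ => κ.comap (fun y : (i : ↥(Finset.Iic m)) → Ω => y ⟨m, Finset.mem_Iic.2 le_rfl⟩)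
            (measurable_pi_apply _))).real
        {x | s ≤ (∑ i ∈ Finset.range N, f (x i)) / N - ∫ z, f z ∂π}
      ≤ Real.exp (-(N * s - 4 * (C + |∫ z, f z ∂π|) / ε.toReal) ^ 2
          / (8 * N * (C + |∫ z, f z ∂π|) ^ 2 / ε.toReal ^ 2)) := by
  set P := Kernel.trajMeasure (X := fun _ : ℕ => Ω) μ₀
      (fun m : ℕ => κ.comap (fun y : (i : ↥(Finset.Iic m)) → Ω => y ⟨m, Finset.mem_Iic.2 le_rfl⟩)
        (measurable_pi_apply _)) with hP
  set m := ∫ z, f z ∂π with hm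
  have hgm : Measurable (fun y => f y - m) := hf.sub measurable_const
  have hgb : ∀ y, |f y - m| ≤ C + |m| := fun y => (abs_sub _ _).trans (add_le_add (hC y) le_rfl)
  have hg0 : ∫ y, (f y - m) ∂π = 0 := by
    rw [integral_sub (integrable_of_bounded π hf hC) (integrable_const _), integral_const,
      probReal_univ, one_smul, hm, sub_self]
  obtain ⟨-, -, -, -, -, hεr0⟩ := half_const_bounds hmin hε0
  -- the Poisson solution `h − Kh = f − m`, `|h| ≤ B := 2C'/ε`
  obtain ⟨h, hh, hhb, hpois⟩ := poisson_exists_of_doeblin hπ hmin hε0 hgm hgb hg0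
  set B := 2 * (C + |m|) / ε.toReal with hB
  have hKb : ∀ x, |kop κ h x| ≤ B := abs_kop_le κ hhb
  obtain ⟨n, rfl⟩ : ∃ n, N = n + 1 := Nat.exists_eq_succ_of_ne_zero hN
  -- telescoping: `Σ_{i<n+1} (f(x_i) − m) = M_n(x) + h(x_0) − Kh(x_n)`
  have htel : ∀ x : ℕ → Ω, ∑ i ∈ Finset.range (n + 1), (f (x i) - m)
      = ∑ i ∈ Finset.range n, (h (x (i + 1)) - kop κ h (x i)) + h (x 0) - kop κ h (x n) := fun x => by
    have hre : ∀ i, f (x i) - m = h (x i) - kop κ h (x i) := fun i => (hpois (x i)).symm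
    simp_rw [hre]
    rw [Finset.sum_sub_distrib, Finset.sum_sub_distrib, Finset.sum_range_succ' (fun i => h (x i)),
      Finset.sum_range_succ (fun i => kop κ h (x i))]
    ring
  -- the event is contained in a martingale tail event
  have hNpos : (0 : ℝ) < (n + 1 : ℕ) := by exact_mod_cast Nat.succ_pos n
  have hsub : {x : ℕ → Ω | s ≤ (∑ i ∈ Finset.range (n + 1), f (x i)) / (n + 1 : ℕ) - m}
      ⊆ {x | (n + 1 : ℕ) * s - 2 * B ≤ ∑ i ∈ Finset.range n, (h (x (i + 1)) - kop κ h (x i))} := by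
    intro x hx
    simp only [Set.mem_setOf_eq] at hx ⊢
    have h1 : (∑ i ∈ Finset.range (n + 1), f (x i)) / (n + 1 : ℕ) - m
        = (∑ i ∈ Finset.range (n + 1), (f (x i) - m)) / (n + 1 : ℕ) := by
      rw [Finset.sum_sub_distrib, Finset.sum_const, Finset.card_range, nsmul_eq_mul]
      field_simp
    rw [h1, htel x, le_div_iff₀ hNpos] at hx
    have h2 : h (x 0) - kop κ h (x n) ≤ 2 * B := by
      linarith [(abs_le.1 (hhb (x 0))).2, (abs_le.1 (hKb (x n))).1]
    linarith
  have hu : 0 ≤ ((n + 1 : ℕ) : ℝ) * s - 2 * B := by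
    rw [hB]
    have : 2 * (2 * (C + |m|) / ε.toReal) = 4 * (C + |m|) / ε.toReal := by ring
    linarith
  have htail := chain_martingale_tail_le κ μ₀ hh hhb n hu
  rw [← hP] at htail
  calc P.real {x | s ≤ (∑ i ∈ Finset.range (n + 1), f (x i)) / (n + 1 : ℕ) - m}
      ≤ P.real {x | (n + 1 : ℕ) * s - 2 * B ≤ ∑ i ∈ Finset.range n, (h (x (i + 1)) - kop κ h (x i))} :=
        measureReal_mono hsub
    _ ≤ Real.exp (-(((n + 1 : ℕ) : ℝ) * s - 2 * B) ^ 2 / (2 * ((n + 1) * B ^ 2))) := htail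
    _ = Real.exp (-(((n + 1 : ℕ) : ℝ) * s - 4 * (C + |m|) / ε.toReal) ^ 2
          / (8 * ((n + 1 : ℕ) : ℝ) * (C + |m|) ^ 2 / ε.toReal ^ 2)) := by
        congr 1
        rw [hB]
        push_cast
        rw [show 2 * (2 * (C + |m|) / ε.toReal) = 4 * (C + |m|) / ε.toReal by ring]
        congr 1
        field_simp
        ring

/-- **Two-sided**: under the same hypotheses,
`P_{μ₀}(|(1/N) Σ_{i<N} f(X_i) − πf| ≥ s) ≤ 2 exp(−(N s − 4C'/ε)² / (8 N C'²/ε²))`. -/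
theorem chain_abs_tail_le_exp_of_doeblin (hπ : Kernel.Invariant κ π) {ε : ℝ≥0∞}
    (hmin : ∀ x {B : Set Ω}, MeasurableSet B → ε * π B ≤ κ x B) (hε0 : 0 < ε)
    {f : Ω → ℝ} (hf : Measurable f) {C : ℝ} (hC : ∀ x, |f x| ≤ C) {N : ℕ} (hN : N ≠ 0) {s : ℝ}
    (hs : 4 * (C + |∫ z, f z ∂π|) / ε.toReal ≤ N * s) :
    (Kernel.trajMeasure (X := fun _ : ℕ => Ω) μ₀
          (fun m : ℕ => κ.comap (fun y : (i : ↥(Finset.Iic m)) → Ω => y ⟨m, Finset.mem_Iic.2 le_rfl⟩)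
            (measurable_pi_apply _))).real
        {x | s ≤ |(∑ i ∈ Finset.range N, f (x i)) / N - ∫ z, f z ∂π|}
      ≤ 2 * Real.exp (-(N * s - 4 * (C + |∫ z, f z ∂π|) / ε.toReal) ^ 2
          / (8 * N * (C + |∫ z, f z ∂π|) ^ 2 / ε.toReal ^ 2)) := by
  set P := Kernel.trajMeasure (X := fun _ : ℕ => Ω) μ₀
      (fun m : ℕ => κ.comap (fun y : (i : ↥(Finset.Iic m)) → Ω => y ⟨m, Finset.mem_Iic.2 le_rfl⟩)
        (measurable_pi_apply _)) with hP
  set m := ∫ z, f z ∂π with hm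
  -- the upper tail
  have hup := chain_tail_le_exp_of_doeblin (μ₀ := μ₀) hπ hmin hε0 hf hC hN hs
  rw [← hP, ← hm] at hup
  -- the lower tail = the upper tail of `−f`
  have hnm : ∫ z, -f z ∂π = -m := by rw [integral_neg, hm]
  have hC' : ∀ x, |(-f x)| ≤ C := fun x => by rw [abs_neg]; exact hC x
  have hs' : 4 * (C + |∫ z, -f z ∂π|) / ε.toReal ≤ N * s := by rwa [hnm, abs_neg]
  have hlow := chain_tail_le_exp_of_doeblin (μ₀ := μ₀) (f := fun z => -f z) hπ hmin hε0 hf.neg hC'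
    hN hs'
  beta_reduce at hlow
  rw [← hP, hnm, abs_neg] at hlow
  have hset : {x : ℕ → Ω | s ≤ |(∑ i ∈ Finset.range N, f (x i)) / N - m|}
      ⊆ {x | s ≤ (∑ i ∈ Finset.range N, f (x i)) / N - m}
        ∪ {x | s ≤ (∑ i ∈ Finset.range N, -f (x i)) / N - -m} := by
    intro x hx
    simp only [Set.mem_setOf_eq, Set.mem_union] at hx ⊢
    rcases le_abs'.1 hx with h1 | h2
    · right
      rw [Finset.sum_neg_distrib, neg_div]
      linarith
    · left; exact h2
  calc P.real {x | s ≤ |(∑ i ∈ Finset.range N, f (x i)) / N - m|}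
      ≤ P.real ({x | s ≤ (∑ i ∈ Finset.range N, f (x i)) / N - m}
          ∪ {x | s ≤ (∑ i ∈ Finset.range N, -f (x i)) / N - -m}) := measureReal_mono hset
    _ ≤ P.real {x | s ≤ (∑ i ∈ Finset.range N, f (x i)) / N - m}
          + P.real {x | s ≤ (∑ i ∈ Finset.range N, -f (x i)) / N - -m} := measureReal_union_le _ _
    _ ≤ _ := by linarith

end Doeblin

end Summit.Ventures.LatticeQCDFlow.Scoring

end
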